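import Mathlib.LinearAlgebra.FreeModule.Finite.Quotient
import Mathlib.LinearAlgebra.FreeModule.Norm
import Mathlib.RingTheory.AdjoinRoot
import HarnessLib

/-!
# The dimension of `M ⧸ φ(M)` over `F` is the degree of `det φ` (modules over `F[X]`)

Topic: `Literature/LinearAlgebra/FreeModule`. Let `F` be a field, `M` a finite free
`F[X]`-module and `φ : M → M` an injective `F[X]`-linear map (equivalently `det φ ≠ 0`). Then
`M ⧸ φ(M)` is a finite-dimensional `F`-vector space of dimension `deg (det φ)`
(`finrank_quotient_range_eq_natDegree_det`). Proof: by the Smith normal form over the principal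
ideal domain `F[X]` (Mathlib `Submodule.smithNormalFormTopBasis` / `…BotBasis` / `…Coeffs`) there
is a basis `(vᵢ)` of `M` and non-zero `aᵢ ∈ F[X]` with `(aᵢ vᵢ)` a basis of `φ(M)`; then
`M ⧸ φ(M) ≅ ⊕ᵢ F[X]/(aᵢ)` has dimension `Σ deg aᵢ` (Mathlib `Submodule.finrank_quotient_eq_sum`,
`AdjoinRoot.powerBasis`), and `det φ` is associated with `∏ aᵢ`
(`associated_det_prod_smithNormalFormCoeffs`, over any PID: `φ = D ∘ e` for the diagonal map
`D vᵢ = aᵢ vᵢ` and the automorphism `e : M ≃ φ(M) ≃ M`, `Σ cᵢaᵢvᵢ ↦ Σ cᵢvᵢ`; Mathlib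
`LinearMap.associated_det_of_eq_comp`), so the degrees agree. This is the `F[X]`-instance of
"the length of the cokernel of an injective endomorphism of a finite free module is the
order of its determinant" (Stacks 02QG over a discrete valuation ring; invariant factors,
Bourbaki *Algèbre* VII §4); Mathlib has the special case of multiplication by an element of a
finite free `F[X]`-algebra (`finrank_quotient_span_eq_natDegree_norm`), whose proof we follow.
It is the local input of Riemann–Roch-type index computations for lattices over `F[X]`
(vector bundles on `ℙ¹_F`).

## References

* The Stacks Project, Tag 02QG. [StacksProject]
-/

noncomputable section

open Module Polynomial

namespace Literature.LinearAlgebra.FreeModule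

section PID

variable {R : Type*} [CommRing R] [IsDomain R] [IsPrincipalIdealRing R]
variable {M : Type*} [AddCommGroup M] [Module R M]
variable {ι : Type*} [Fintype ι]

/-- **`det φ` is associated with the product of the Smith coefficients of `φ(M) ⊆ M`** for an
injective endomorphism `φ` of a finite free module over a PID: with the Smith bases `(vᵢ)` of
`M` and `(aᵢvᵢ)` of `φ(M)` (Mathlib `Submodule.smithNormalFormTopBasis`, `…BotBasis_def`),
`φ = D ∘ e` where `D vᵢ = aᵢ vᵢ` has determinant `∏ aᵢ` and `e` is the automorphism
`M ≃ φ(M) ≃ M`, `x ↦ φ x = Σ cᵢaᵢvᵢ ↦ Σ cᵢvᵢ` (Mathlib `LinearMap.associated_det_of_eq_comp`;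
compare Mathlib `associated_norm_prod_smith` for ideals). [cite: StacksProject, Tag 02QG] -/
theorem associated_det_prod_smithNormalFormCoeffs (b : Basis ι R M) (φ : M →ₗ[R] M)
    (hφ : Function.Injective φ)
    (h : Module.finrank R (LinearMap.range φ) = Module.finrank R M) :
    Associated (LinearMap.det φ) (∏ i, Submodule.smithNormalFormCoeffs b h i) := by
  classical
  set N := LinearMap.range φ with hN
  let a := Submodule.smithNormalFormCoeffs b h
  let bT := Submodule.smithNormalFormTopBasis b h
  let bB := Submodule.smithNormalFormBotBasis b h
  have hbB : ∀ i, (bB i : M) = a i • bT i := Submodule.smithNormalFormBotBasis_def b h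
  -- the diagonal endomorphism `D vᵢ = aᵢ vᵢ`
  let D : M →ₗ[R] M := Matrix.toLin bT bT (Matrix.diagonal a)
  have hD : ∀ i, D (bT i) = a i • bT i := by
    intro i
    rw [Matrix.toLin_self]
    simp [Matrix.diagonal_apply]
  have hdetD : LinearMap.det D = ∏ i, a i := by
    rw [LinearMap.det_toLin, Matrix.det_diagonal]
  -- the automorphism `e : M ≃ φ(M) ≃ M`
  let e₁ : M ≃ₗ[R] N := LinearEquiv.ofInjective φ hφ
  let e₂ : N ≃ₗ[R] M := bB.equiv bT (Equiv.refl ι)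
  have he₂ : N.subtype = D ∘ₗ (e₂ : N →ₗ[R] M) := by
    refine bB.ext fun i => ?_
    rw [LinearMap.comp_apply, LinearEquiv.coe_coe, Basis.equiv_apply, Equiv.refl_apply, hD,
      Submodule.subtype_apply, hbB]
  have key : ∀ x, φ x = D ((e₁.trans e₂) x) := by
    intro x
    have hx : ((e₁ x : N) : M) = φ x := LinearEquiv.ofInjective_apply φ (h := hφ) x
    rw [← hx, ← Submodule.subtype_apply, he₂]
    rfl
  rw [← hdetD]
  exact LinearMap.associated_det_of_eq_comp (e₁.trans e₂) φ D key

/-- The determinant of an injective endomorphism of a finite free module over a PID is non-zero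
(it is associated with the product of the non-zero Smith coefficients). [folklore] -/
theorem det_ne_zero_of_injective (b : Basis ι R M) (φ : M →ₗ[R] M)
    (hφ : Function.Injective φ) : LinearMap.det φ ≠ 0 := by
  classical
  have h := LinearMap.finrank_range_of_inj hφ
  have hne := fun i => Submodule.smithNormalFormCoeffs_ne_zero b h i
  intro h0
  have := (associated_det_prod_smithNormalFormCoeffs b φ hφ h).eq_zero_iff.mp h0
  exact Finset.prod_ne_zero_iff.mpr (fun i _ => hne i) this

end PID

section Field

variable {F : Type*} [Field F]
variable {M : Type*} [AddCommGroup M] [Module F[X] M] [Module F M] [IsScalarTower F F[X] M]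
variable {ι : Type*} [Fintype ι]

/-- **`dim_F (M ⧸ φ(M)) = deg (det φ)`** for an injective `F[X]`-linear endomorphism `φ` of a
finite free `F[X]`-module `M` (`F` a field): `M ⧸ φ(M) ≅ ⊕ᵢ F[X]/(aᵢ)` by the Smith normal form
(Mathlib `Submodule.finrank_quotient_eq_sum`), `dim_F F[X]/(aᵢ) = deg aᵢ`
(`AdjoinRoot.powerBasis`), and `det φ ∼ ∏ aᵢ` (`associated_det_prod_smithNormalFormCoeffs`).
[cite: StacksProject, Tag 02QG] -/
theorem finrank_quotient_range_eq_natDegree_det (b : Basis ι F[X] M) (φ : M →ₗ[F[X]] M)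
    (hφ : Function.Injective φ) :
    Module.finrank F (M ⧸ LinearMap.range φ) = (LinearMap.det φ).natDegree := by
  classical
  have h := LinearMap.finrank_range_of_inj hφ
  have hne := fun i => Submodule.smithNormalFormCoeffs_ne_zero b h i
  rw [natDegree_eq_of_degree_eq
      (degree_eq_degree_of_associated (associated_det_prod_smithNormalFormCoeffs b φ hφ h)),
    natDegree_prod _ _ fun i _ => hne i]
  haveI : ∀ i, Module.Finite F (F[X] ⧸ Ideal.span {Submodule.smithNormalFormCoeffs b h i}) :=
    fun i => PowerBasis.finite (AdjoinRoot.powerBasis (hne i))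
  rw [Submodule.finrank_quotient_eq_sum F b h]
  refine Finset.sum_congr rfl fun i _ => ?_
  exact (AdjoinRoot.powerBasis (hne i)).finrank

end Field

end Literature.LinearAlgebra.FreeModule

end
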